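import Summits.CriticalPhenomena.CardyFormulaZ2.Theorems.CardyComplexConeParafermionToSLESixFamiliesDiamondIdentifyLoopEdges
import Summits.CriticalPhenomena.CardyFormulaZ2.Theorems.CardyComplexConeParafermionToSLESixFamiliesDiamondTracePos
import Mathlib.Topology.Algebra.Order.Floor
import HarnessLib

/-!
# The counter-clockwise boundary loop of a marked diamond in its frame, and the boundary position along it
# (line `potential-darboux-picard-diamond`, S1p `stub_boundaryDartPhase`, part 8)

Crux `ParafermionToSLESixFamilies` (stmt-CriticalPhenomena-11389), line `potential-darboux-picard-diamond`, stub
`stub_boundaryDartPhase` (S1p). `exists_boundaryLoop` (`…DiamondIdentifyLoop.lean`) parametrises the frontier of a marked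
diamond counter-clockwise by a continuous `2π`-periodic loop, injective on a period, but hides the corners behind an
existential. The comparison of the arcs `D.arc i` (which `arcs_eq_of_loop` expresses through loop parameters) with the mark
count of `diamondTau` (expressed through the boundary position `dPos` of the frame, `…DiamondTracePos.lean`) needs the loop IN
THE FRAME: `exists_boundaryLoop_frame` (registered) re-runs the construction for a Dobrushin domain whose carrier is the open
rotated rectangle with centre `c` and half-widths `α, β` and records that the parameter interval `[kπ/2, (k+1)π/2]` is mapped
affinely onto side `k + 1 (mod 4)` of the frame (`dRot c (ℓ ((k + r)π/2)) = dParam (k+1) (r · dLen (k+1))`). Consequently on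
the period window `[-π/2, 3π/2)` (cut at the corner `(-α, -β)`) every parameter decomposes as `-π/2 + (k + r)π/2` with the loop
point `dParam k (r · dLen k)` (`loop_decomp`), and the boundary position `dPos ∘ dRot c ∘ ℓ` is strictly increasing there
(`dPos_loop_strictMonoOn`): counter-clockwise order along the loop IS the order of boundary positions.
-/

noncomputable section

namespace Summit.CriticalPhenomena.CardyFormulaZ2.Cruxes.ParafermionToSLESixFamilies.PotentialDarbouxPicardDiamond

open scoped Topology ComplexConjugate
open Filter Set Metric Complex
open Literature.Probability.RandomPlanarGeometry

/-! ## The boundary loop in the frame -/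

/-- **The counter-clockwise boundary loop of a marked diamond, in its frame** (registered helper of
`stub_boundaryDartPhase`). See the module docstring. -/
theorem exists_boundaryLoop_frame : ∀ (D : DobrushinDomain) (c : ℂ) (α β : ℝ), 0 < α → 0 < β → D.carrier = {z | |((z - c) * exp (-(Real.pi / 4 : ℝ) * I)).re| < α ∧ |((z - c) * exp (-(Real.pi / 4 : ℝ) * I)).im| < β} → ∃ (ℓ : ℝ → ℂ), Continuous ℓ ∧ (∀ s : ℝ, ℓ (s + 2 * Real.pi) = ℓ s) ∧ Set.range ℓ = frontier D.carrier ∧ Set.InjOn ℓ (Set.Ico 0 (2 * Real.pi)) ∧ (∀ (k : ℕ) (r : ℝ), 0 ≤ r → r ≤ 1 → (k % 4 = 0 → dRot c (ℓ ((k + r) * (Real.pi / 2))) = dParam α β 1 (r * dLen α β 1)) ∧ (k % 4 = 1 → dRot c (ℓ ((k + r) * (Real.pi / 2))) = dParam α β 2 (r * dLen α β 2)) ∧ (k % 4 = 2 → dRot c (ℓ ((k + r) * (Real.pi / 2))) = dParam α β 3 (r * dLen α β 3)) ∧ (k % 4 = 3 → dRot c (ℓ ((k + r) * (Real.pi / 2)))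 = dParam α β 0 (r * dLen α β 0))) := by
  intro D c α β hα hβ hcar
  set e : ℂ := exp (-(Real.pi / 4 : ℝ) * I) with hedef
  have he1 : ‖e‖ = 1 := norm_exp_neg_pi_div_four_mul_I
  have hπ := Real.pi_pos
  obtain ⟨W, hWper, hW0, hW1, hW2, hW3⟩ := cornerOffset_spec α β
  -- the corners
  set P : ℕ → ℂ := fun k => c + conj e * W k with hP
  have hPper : ∀ k, P (k + 4) = P k := fun k => by simp only [hP]; rw [hWper]
  have hP4 : P 4 = P 0 := hPper 0
  -- the one-period map `F` on `[0, 1]` and the loop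
  set F : ℝ → ℂ := fun r =>
    if r ≤ 1 / 4 then P 0 + ((4 * r : ℝ) : ℂ) * (P 1 - P 0)
    else if r ≤ 2 / 4 then P 1 + ((4 * r - 1 : ℝ) : ℂ) * (P 2 - P 1)
    else if r ≤ 3 / 4 then P 2 + ((4 * r - 2 : ℝ) : ℂ) * (P 3 - P 2)
    else P 3 + ((4 * r - 3 : ℝ) : ℂ) * (P 4 - P 3) with hF
  have hFc : Continuous F := by
    simp only [hF]
    refine Continuous.if_le (by fun_prop) ?_ continuous_id continuous_const (fun r hr => ?_)
    · refine Continuous.if_le (by fun_prop) ?_ continuous_id continuous_const (fun r hr => ?_)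
      · refine Continuous.if_le (by fun_prop) (by fun_prop) continuous_id continuous_const (fun r hr => ?_)
        rw [hr]; push_cast; ring
      · rw [hr, if_pos (by norm_num : (2 / 4 : ℝ) ≤ 3 / 4)]; push_cast; ring
    · rw [hr, if_pos (by norm_num : (1 / 4 : ℝ) ≤ 2 / 4)]; push_cast; ring
  have hF01 : F 0 = F 1 := by
    simp only [hF]
    rw [if_pos (by norm_num : (0:ℝ) ≤ 1 / 4), if_neg (by norm_num : ¬ (1:ℝ) ≤ 1 / 4),
      if_neg (by norm_num : ¬ (1:ℝ) ≤ 2 / 4), if_neg (by norm_num : ¬ (1:ℝ) ≤ 3 / 4), hP4]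
    push_cast; ring
  set ℓ : ℝ → ℂ := fun s => F (Int.fract (s / (2 * Real.pi))) with hℓ
  have hℓc : Continuous ℓ := (hFc.continuousOn.comp_fract'' hF01).comp (continuous_id.div_const _)
  have hℓper : ∀ s, ℓ (s + 2 * Real.pi) = ℓ s := fun s => by
    simp only [hℓ]; rw [add_div, div_self (by positivity), Int.fract_add_one]
  -- the piece formula on one period
  have hpiece0 : ∀ (k : ℕ) (r : ℝ), k < 4 → 0 ≤ r → r ≤ 1 →
      ℓ ((k + r) * (Real.pi / 2)) = P k + r * (P (k + 1) - P k) := by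
    intro k r hk hr0 hr1
    simp only [hℓ]
    have hdiv : (k + r) * (Real.pi / 2) / (2 * Real.pi) = (k + r) / 4 := by field_simp; ring
    rw [hdiv]
    by_cases htop : (k : ℝ) + r = 4
    · have hk3 : k = 3 := by
        have : (3 : ℝ) ≤ k := by linarith
        have : 3 ≤ k := by exact_mod_cast this
        omega
      subst hk3
      have hr : r = 1 := by push_cast at htop; linarith
      rw [htop, div_self (by norm_num), Int.fract_one, hr]
      show F 0 = _
      simp only [hF]; rw [if_pos (by norm_num : (0:ℝ) ≤ 1 / 4)]
      push_cast; rw [hP4]; ring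
    have hk3 : (k : ℝ) ≤ 3 := by exact_mod_cast Nat.lt_succ_iff.1 hk
    have hlt : ((k : ℝ) + r) / 4 < 1 := by
      rw [div_lt_one (by norm_num)]; exact lt_of_le_of_ne (by linarith) htop
    rw [Int.fract_eq_self.2 ⟨by positivity, hlt⟩]
    simp only [hF]
    interval_cases k
    · rw [if_pos (by push_cast; linarith)]; push_cast; ring
    · by_cases h0 : r = 0
      · subst h0; rw [if_pos (by norm_num)]; push_cast; ring
      · have hr0' : 0 < r := lt_of_le_of_ne hr0 (Ne.symm h0)
        rw [if_neg (by push_cast; linarith), if_pos (by push_cast; linarith)]; push_cast; ring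
    · by_cases h0 : r = 0
      · subst h0; rw [if_neg (by norm_num), if_pos (by norm_num)]; push_cast; ring
      · have hr0' : 0 < r := lt_of_le_of_ne hr0 (Ne.symm h0)
        rw [if_neg (by push_cast; linarith), if_neg (by push_cast; linarith), if_pos (by push_cast; linarith)]
        push_cast; ring
    · by_cases h0 : r = 0
      · subst h0; rw [if_neg (by norm_num), if_neg (by norm_num), if_pos (by norm_num)]; push_cast; ring
      · have hr0' : 0 < r := lt_of_le_of_ne hr0 (Ne.symm h0)
        rw [if_neg (by push_cast; linarith), if_neg (by push_cast; linarith), if_neg (by push_cast; linarith)]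
        push_cast; ring
  -- the piece formula for all `k`
  have hperN : ∀ (n : ℕ) (s : ℝ), ℓ (s + n * (2 * Real.pi)) = ℓ s := by
    intro n s
    induction n with
    | zero => simp
    | succ n ih => rw [show s + ((n + 1 : ℕ) : ℝ) * (2 * Real.pi) = (s + n * (2 * Real.pi)) + 2 * Real.pi by
        push_cast; ring, hℓper, ih]
  have hpiece : ∀ (k : ℕ) (r : ℝ), 0 ≤ r → r ≤ 1 → ℓ ((k + r) * (Real.pi / 2)) = P k + r * (P (k + 1) - P k) := by
    intro k r hr0 hr1
    have hPk : P k = P (k % 4) := by simp only [hP]; rw [← periodic4_mod hWper]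
    have hPk1 : P (k + 1) = P (k % 4 + 1) := by
      have : (k + 1) % 4 = (k % 4 + 1) % 4 := by omega
      simp only [hP]; rw [periodic4_mod hWper (k + 1), periodic4_mod hWper (k % 4 + 1), this]
    have hs : ((k : ℝ) + r) * (Real.pi / 2) = ((k % 4 : ℕ) + r) * (Real.pi / 2) + (k / 4 : ℕ) * (2 * Real.pi) := by
      have : (k : ℝ) = (k % 4 : ℕ) + 4 * (k / 4 : ℕ) := by exact_mod_cast (Nat.mod_add_div k 4).symm
      rw [this]; ring
    rw [hs, hperN, hpiece0 _ r (Nat.mod_lt _ (by norm_num)) hr0 hr1, ← hPk, ← hPk1]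
  -- decomposition of a parameter of `[0, 2π)`
  have hdecomp : ∀ s ∈ Ico (0:ℝ) (2 * Real.pi), ∃ (k : ℕ) (r : ℝ), k < 4 ∧ 0 ≤ r ∧ r < 1 ∧
      s = (k + r) * (Real.pi / 2) := by
    intro s hs
    set x : ℝ := s / (Real.pi / 2) with hx
    have hx0 : 0 ≤ x := div_nonneg hs.1 (by positivity)
    have hx4 : x < 4 := by rw [hx, div_lt_iff₀ (by positivity)]; linarith [hs.2]
    refine ⟨⌊x⌋₊, x - ⌊x⌋₊, ?_, ?_, ?_, ?_⟩
    · have : (⌊x⌋₊ : ℝ) < 4 := lt_of_le_of_lt (Nat.floor_le hx0) hx4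
      exact_mod_cast this
    · linarith [Nat.floor_le hx0]
    · linarith [Nat.lt_floor_add_one x]
    · rw [add_sub_cancel, hx]; field_simp
  -- injectivity on one period
  have hinj : InjOn ℓ (Ico 0 (2 * Real.pi)) := by
    intro s hs s' hs' hss'
    obtain ⟨k, r, hk, hr0, hr1, rfl⟩ := hdecomp s hs
    obtain ⟨k', r', hk', hr0', hr1', rfl⟩ := hdecomp s' hs'
    rw [hpiece0 k r hk hr0 hr1.le, hpiece0 k' r' hk' hr0' hr1'.le] at hss'
    obtain ⟨rfl, rfl⟩ := edge_inj c e he1 hα hβ hWper hW0 hW1 hW2 hW3 hk hk' hr1 hr1' hss'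
    rfl
  -- the range is the frontier
  have hrange : range ℓ = frontier D.carrier := by
    apply Subset.antisymm
    · rintro _ ⟨s, rfl⟩
      have hs' : ℓ s = ℓ (Int.fract (s / (2 * Real.pi)) * (2 * Real.pi)) := by
        simp only [hℓ]; rw [mul_div_cancel_right₀ _ (by positivity), Int.fract_fract]
      rw [hs']
      have hmemI : Int.fract (s / (2 * Real.pi)) * (2 * Real.pi) ∈ Ico (0:ℝ) (2 * Real.pi) :=
        ⟨mul_nonneg (Int.fract_nonneg _) (by positivity),
          by nlinarith [Int.fract_lt_one (s / (2 * Real.pi)), Int.fract_nonneg (s / (2 * Real.pi))]⟩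
      obtain ⟨k, r, hk, hr0, hr1, hkr⟩ := hdecomp _ hmemI
      rw [hkr, hpiece0 k r hk hr0 hr1.le, hcar]
      exact edge_mem_frontier c e he1 hα hβ hWper hW0 hW1 hW2 hW3 k hr0 hr1.le
    · intro z hz
      rw [hcar] at hz
      obtain ⟨k, r, -, hr0, hr1, rfl⟩ := exists_edge_of_mem_frontier c e he1 hα hβ hWper hW0 hW1 hW2 hW3 hz
      exact ⟨(k + r) * (Real.pi / 2), hpiece k r hr0 hr1⟩
  -- turning, orientation, the centre
  have hc_mem : c ∈ D.carrier := by
    rw [hcar]; simp only [mem_setOf_eq, sub_self, zero_mul, zero_re, zero_im, abs_zero]; exact ⟨hα, hβ⟩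
  have hconv : Convex ℝ D.carrier := by rw [hcar]; exact convex_tiltedBox c e α β
  have hleft : ∀ z ∈ D.carrier, ∀ k : ℕ, 0 < ((z - P k) * conj (P (k + 1) - P k)).im := by
    intro z hz k
    have hzin : |((z - c) * e).re| < α ∧ |((z - c) * e).im| < β := by rw [hcar] at hz; exact hz
    exact (turn_and_left c e he1 hα hβ hWper hW0 hW1 hW2 hW3 k).2 z hzin.1 hzin.2
  have hPne : ∀ k, P k ≠ P (k + 1) := by
    intro k heq
    have := hleft c hc_mem k
    rw [← heq, sub_self, map_zero, mul_zero, zero_im] at this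
    exact lt_irrefl _ this
  -- the frame of the edges
  have hframe : ∀ (k : ℕ) (r : ℝ), 0 ≤ r → r ≤ 1 →
      (k % 4 = 0 → dRot c (ℓ ((k + r) * (Real.pi / 2))) = dParam α β 1 (r * dLen α β 1)) ∧
      (k % 4 = 1 → dRot c (ℓ ((k + r) * (Real.pi / 2))) = dParam α β 2 (r * dLen α β 2)) ∧
      (k % 4 = 2 → dRot c (ℓ ((k + r) * (Real.pi / 2))) = dParam α β 3 (r * dLen α β 3)) ∧
      (k % 4 = 3 → dRot c (ℓ ((k + r) * (Real.pi / 2))) = dParam α β 0 (r * dLen α β 0)) := by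
    intro k r hr0 hr1
    rw [hpiece k r hr0 hr1]
    obtain ⟨A, B, hAB, hcases⟩ := edge_coords c e he1 hWper hW0 hW1 hW2 hW3 k r
    have hrot : dRot c (P k + (r : ℂ) * (P (k + 1) - P k)) = (A : ℂ) + (B : ℂ) * I := by
      rw [← hAB]; simp only [dRot, hP, hedef]
    rw [hrot]
    refine ⟨fun h => ?_, fun h => ?_, fun h => ?_, fun h => ?_⟩
    · rcases hcases with ⟨-, hA, hB⟩ | ⟨h', -, -⟩ | ⟨h', -, -⟩ | ⟨h', -, -⟩
      · rw [hA, hB]; apply Complex.ext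
        · simp [dParam, dCorner, dDir, dLen]
        · simp [dParam, dCorner, dDir, dLen]; ring
      all_goals omega
    · rcases hcases with ⟨h', -, -⟩ | ⟨-, hA, hB⟩ | ⟨h', -, -⟩ | ⟨h', -, -⟩
      · omega
      · rw [hA, hB]; apply Complex.ext
        · simp [dParam, dCorner, dDir, dLen]; ring
        · simp [dParam, dCorner, dDir, dLen]
      all_goals omega
    · rcases hcases with ⟨h', -, -⟩ | ⟨h', -, -⟩ | ⟨-, hA, hB⟩ | ⟨h', -, -⟩
      · omega
      · omega
      · rw [hA, hB]; apply Complex.ext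
        · simp [dParam, dCorner, dDir, dLen]
        · simp [dParam, dCorner, dDir, dLen]; ring
      · omega
    · rcases hcases with ⟨h', -, -⟩ | ⟨h', -, -⟩ | ⟨h', -, -⟩ | ⟨-, hA, hB⟩
      · omega
      · omega
      · omega
      · rw [hA, hB]; apply Complex.ext
        · simp [dParam, dCorner, dDir, dLen]; ring
        · simp [dParam, dCorner, dDir, dLen]
  exact ⟨ℓ, hℓc, hℓper, hrange, hinj, hframe⟩


/-! ## The boundary position along the loop -/

/-- The block offsets are the multiples of the block width. -/
theorem dLo_eq_mul (α β : ℝ) (k : Fin 4) : dLo α β k = (k.val : ℝ) * dBlock α β := by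
  fin_cases k <;> simp [dLo]

section Position

variable {c : ℂ} {α β : ℝ} (hα : 0 < α) (hβ : 0 < β) {ℓ : ℝ → ℂ} (hper : ∀ s : ℝ, ℓ (s + 2 * Real.pi) = ℓ s)
  (hframe : ∀ (k : ℕ) (r : ℝ), 0 ≤ r → r ≤ 1 →
    (k % 4 = 0 → dRot c (ℓ ((k + r) * (Real.pi / 2))) = dParam α β 1 (r * dLen α β 1)) ∧
    (k % 4 = 1 → dRot c (ℓ ((k + r) * (Real.pi / 2))) = dParam α β 2 (r * dLen α β 2)) ∧
    (k % 4 = 2 → dRot c (ℓ ((k + r) * (Real.pi / 2))) = dParam α β 3 (r * dLen α β 3)) ∧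
    (k % 4 = 3 → dRot c (ℓ ((k + r) * (Real.pi / 2))) = dParam α β 0 (r * dLen α β 0)))

include hper hframe in
/-- **Decomposition of a parameter of the window `[-π/2, 3π/2)`**: `t = -π/2 + (k + r)π/2` with `k : Fin 4`, `r ∈ [0, 1)`,
and the loop point is `dParam k (r · dLen k)` in the frame. -/
theorem loop_decomp {t : ℝ} (ht : t ∈ Ico (-(Real.pi / 2)) (3 * Real.pi / 2)) :
    ∃ (k : Fin 4) (r : ℝ), 0 ≤ r ∧ r < 1 ∧ t = -(Real.pi / 2) + (k.val + r) * (Real.pi / 2) ∧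
      dRot c (ℓ t) = dParam α β k (r * dLen α β k) := by
  have hπ := Real.pi_pos
  set x : ℝ := (t + Real.pi / 2) / (Real.pi / 2) with hx
  have hx0 : 0 ≤ x := div_nonneg (by linarith [ht.1]) (by positivity)
  have hx4 : x < 4 := by rw [hx, div_lt_iff₀ (by positivity)]; linarith [ht.2]
  set n : ℕ := ⌊x⌋₊ with hn
  have hn4 : n < 4 := by
    have : (n : ℝ) < 4 := lt_of_le_of_lt (Nat.floor_le hx0) hx4
    exact_mod_cast this
  set r : ℝ := x - n with hr
  have hr0 : 0 ≤ r := by rw [hr]; linarith [Nat.floor_le hx0]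
  have hr1 : r < 1 := by rw [hr]; linarith [Nat.lt_floor_add_one x]
  have ht' : t = -(Real.pi / 2) + (n + r) * (Real.pi / 2) := by
    rw [hr, add_sub_cancel, hx]; field_simp; ring
  interval_cases n
  · refine ⟨0, r, hr0, hr1, by simpa using ht', ?_⟩
    have := ((hframe 3 r hr0 hr1.le).2.2.2 rfl)
    rw [← hper t]
    rw [ht', show -(Real.pi / 2) + ((0 : ℕ) + r) * (Real.pi / 2) + 2 * Real.pi = ((3 : ℕ) + r) * (Real.pi / 2) by
      push_cast; ring]
    exact this
  · refine ⟨1, r, hr0, hr1, by simpa using ht', ?_⟩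
    have := ((hframe 0 r hr0 hr1.le).1 rfl)
    rw [ht', show -(Real.pi / 2) + ((1 : ℕ) + r) * (Real.pi / 2) = ((0 : ℕ) + r) * (Real.pi / 2) by push_cast; ring]
    exact this
  · refine ⟨2, r, hr0, hr1, by simpa using ht', ?_⟩
    have := ((hframe 1 r hr0 hr1.le).2.1 rfl)
    rw [ht', show -(Real.pi / 2) + ((2 : ℕ) + r) * (Real.pi / 2) = ((1 : ℕ) + r) * (Real.pi / 2) by push_cast; ring]
    exact this
  · refine ⟨3, r, hr0, hr1, by simpa using ht', ?_⟩
    have := ((hframe 2 r hr0 hr1.le).2.2.1 rfl)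
    rw [ht', show -(Real.pi / 2) + ((3 : ℕ) + r) * (Real.pi / 2) = ((2 : ℕ) + r) * (Real.pi / 2) by push_cast; ring]
    exact this

include hα hβ hper hframe in
/-- **The boundary position of a loop point of the window**: `dPos = dLo k + r · dLen k`. -/
theorem dPos_loop_of_decomp {t : ℝ} {k : Fin 4} {r : ℝ} (hr0 : 0 ≤ r) (hr1 : r < 1)
    (ht : t = -(Real.pi / 2) + (k.val + r) * (Real.pi / 2)) :
    dRot c (ℓ t) = dParam α β k (r * dLen α β k) ∧ dPos α β (dRot c (ℓ t)) = dLo α β k + r * dLen α β k := by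
  have hπ := Real.pi_pos
  have hmem : t ∈ Ico (-(Real.pi / 2)) (3 * Real.pi / 2) := by
    have hk : (k.val : ℝ) ≤ 3 := by exact_mod_cast Nat.lt_succ_iff.1 k.isLt
    rw [ht]; constructor <;> nlinarith
  obtain ⟨k', r', hr0', hr1', ht', hrot⟩ := loop_decomp hper hframe hmem
  -- the decomposition is unique
  have hkr : (k.val : ℝ) + r = k'.val + r' := by
    have := ht.symm.trans ht'
    nlinarith
  have hkk : k = k' := by
    have h1 : (k.val : ℝ) < k'.val + 1 := by linarith
    have h2 : (k'.val : ℝ) < k.val + 1 := by linarith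
    have h1' : k.val < k'.val + 1 := by exact_mod_cast h1
    have h2' : k'.val < k.val + 1 := by exact_mod_cast h2
    exact Fin.ext (by omega)
  subst hkk
  have hrr : r = r' := by linarith
  subst hrr
  refine ⟨hrot, ?_⟩
  rw [hrot, dPos_dParam hα hβ k (mul_nonneg hr0 (dLen_pos hα hβ k).le)]
  calc r * dLen α β k < 1 * dLen α β k := mul_lt_mul_of_pos_right hr1 (dLen_pos hα hβ k)
    _ = dLen α β k := one_mul _

include hα hβ hper hframe in
/-- **Counter-clockwise order along the loop is the order of boundary positions**: `dPos ∘ dRot c ∘ ℓ` is strictly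
increasing on the window `[-π/2, 3π/2)`. -/
theorem dPos_loop_strictMonoOn :
    StrictMonoOn (fun t => dPos α β (dRot c (ℓ t))) (Ico (-(Real.pi / 2)) (3 * Real.pi / 2)) := by
  intro t ht t' ht' htt'
  have hπ := Real.pi_pos
  obtain ⟨k, r, hr0, hr1, hte, -⟩ := loop_decomp hper hframe ht
  obtain ⟨k', r', hr0', hr1', hte', -⟩ := loop_decomp hper hframe ht'
  obtain ⟨-, hpos⟩ := dPos_loop_of_decomp hα hβ hper hframe hr0 hr1 hte
  obtain ⟨-, hpos'⟩ := dPos_loop_of_decomp hα hβ hper hframe hr0' hr1' hte'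
  simp only
  rw [hpos, hpos', dLo_eq_mul, dLo_eq_mul]
  have hlt : (k.val : ℝ) + r < k'.val + r' := by
    rw [hte, hte'] at htt'
    nlinarith
  have hB : 0 < dBlock α β := by unfold dBlock; linarith
  have hL := dLen_lt_dBlock hα hβ k
  have hL' := dLen_pos hα hβ k'
  have hLk := dLen_pos hα hβ k
  rcases lt_or_ge (k.val : ℝ) k'.val with hk | hk
  · have hk1 : (k.val : ℝ) + 1 ≤ k'.val := by
      have : k.val < k'.val := by exact_mod_cast hk
      exact_mod_cast this
    nlinarith
  · have hkk : k'.val = k.val := by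
      have h2 : (k'.val : ℝ) < k.val + 1 := by linarith
      have h2' : k'.val < k.val + 1 := by exact_mod_cast h2
      have hk' : k'.val ≤ k.val := by exact_mod_cast hk
      have : k.val ≤ k'.val := by
        by_contra hc
        push Not at hc
        have : (k'.val : ℝ) + 1 ≤ k.val := by exact_mod_cast hc
        linarith
      omega
    have hkk' : k' = k := Fin.ext hkk
    subst hkk'
    have hrr : r < r' := by linarith
    nlinarith

end Position

end Summit.CriticalPhenomena.CardyFormulaZ2.Cruxes.ParafermionToSLESixFamilies.PotentialDarbouxPicardDiamond

end
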